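import Literature.NumberTheory.LFunctions.ThetaChainFreeCheck
import HarnessLib

/-!
# Schoenfeld's `θ`-bound on `[599, 10⁸]` by kernel computation: data-free run, chunk 1 of 35

Topic: `Literature/NumberTheory/LFunctions`. Pure proof file (a kernel computation; nothing is
asserted, no definition). The theorems below evaluate `ThetaChain.runFree` — together `150000`
data-free steps of the certified `θ`-chain (`ThetaChain.stepFree`, `ThetaChainFreeCheck.lean`: the
next prime found and certified by two gcds with the primorials of the odd primes `≤ 2999` and in
`(2999, 10007]`, the enclosures of `log p` and `θ(p)`, and the two comparisons behind
`|θ(x) − x| ≤ √x log² x/(8π)`) — from the state at the prime `8886113` (the first literal is the final state of the tree's extended run, `ThetaChainRun.invE_final`) to the state at the prime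
`11305751`. Soundness: `ThetaChain.runFree_sound`; assembly of the 35 chunks: `ThetaUpTo1e8.lean`.
The expected states were obtained by evaluating a twin of the same function outside the kernel
(validated bit-for-bit on the tree's chunk `ThetaChainRun.xrun14`). Declarations of `5·10⁴` steps
(about `70 s` of kernel time each; the kernel's evaluation is linear within a declaration of this size),
`decide +kernel`, standard axioms only (`maxHeartbeats 0` lifts the deterministic time-out).

## References

* L. Schoenfeld, *Sharper bounds for the Chebyshev functions θ(x) and ψ(x). II*, Math. Comp. 30
  (1976), 337–360, Thm. 10 (6.3). [Schoenfeld1976]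
* J. B. Rosser, L. Schoenfeld, *Approximate formulas for some functions of prime numbers*,
  Illinois J. Math. 6 (1962), 64–94, Thms. 18–19 (`θ`-tables to `10⁸`). [RosserSchoenfeld1962]
-/

namespace Literature.NumberTheory.LFunctions.ThetaChainRun

open ThetaChain

set_option maxHeartbeats 0 in
/-- **Data-free certified `θ`-run, chunk 1a** (steps `1`–`50000` after `8886113`: 50000 primes,
`8886113` to `9688199`). [cite: Schoenfeld1976, Thm. 10 (6.3)] -/
theorem frun1a :
    runFree 50000
      ⟨8886113, 19342813451160451275473379, 19342813451160926895289126, 10739163612930417185419074987374, 10739163612930700336935412219133⟩ =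
    some ⟨9688199, 19447287401030538630027731, 19447287401031014250908523, 11708953351926282841746134829436, 11708953351926589774279897331750⟩ := by
  decide +kernel

set_option maxHeartbeats 0 in
/-- **Data-free certified `θ`-run, chunk 1b** (steps `50001`–`100000` after `8886113`: 50000 primes,
`9688199` to `10495781`). [cite: Schoenfeld1976, Thm. 10 (6.3)] -/
theorem frun1b :
    runFree 50000
      ⟨9688199, 19447287401030538630027731, 19447287401031014250908523, 11708953351926282841746134829436, 11708953351926589774279897331750⟩ =
    some ⟨10495781, 19544079829144076151488797, 19544079829144551773433064, 12683772381568665922290575377042, 12683772381568996635895007987936⟩ := by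
  decide +kernel

set_option maxHeartbeats 0 in
/-- **Data-free certified `θ`-run, chunk 1c** (steps `100001`–`150000` after `8886113`: 50000 primes,
`10495781` to `11305751`). [cite: Schoenfeld1976, Thm. 10 (6.3)] -/
theorem frun1c :
    runFree 50000
      ⟨10495781, 19544079829144076151488797, 19544079829144551773433064, 12683772381568665922290575377042, 12683772381568996635895007987936⟩ =
    some ⟨11305751, 19633949159113399574564457, 19633949159113875197560769, 13663247402749386197976899080968, 13663247402749740692704848159387⟩ := by
  decide +kernel

end Literature.NumberTheory.LFunctions.ThetaChainRun
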